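/-
Copyright (c) 2026 the pub-hodgecm-mathlib formalisation cell (harness21).  Prover seat hodgecm-mathlib-K2E3-p32 (g0), HCML Track B «K2-LIT» (close-out strike line L4
`stub_StCharTS`), h413 = `stmt-HodgeConjecture-24833`, line `K2_E3_EllipticInputs`, PART «SC» socket (SC-an)₂ `sig_K2E3SupercuspidalTruncatedCharAnalyticTwo`, the (M5h₂)
chain (dealer K2E3-plan (g4) EMIT #1 2026-09-04T14:52:25Z, deal D137): the `U(1,1)` twin of ★ `K2E3CuspFormCancellationU3Torus` (K2E3-p21 (g3)) — HARISH-CHANDRA'S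
THEOREM 20 «cusp-form cancellation», DISCHARGE at the model `U(σ, Φ₂)(K)`, FILE 1 «THE DIAGONAL TORUS», plus the two Iwahori orders of the level `K_γ ∩ U(σ, Φ_N)(K)`
at ANY rank (over ★ `F0P3cIwahoriDatumU2Alg.coe_level_eq_mul`).  2026-09-04.
-/
import Summits.HodgeConjecture.HodgeConjecture.Theorems.K2E3CuspFormCancellationU3Torus   -- ★ (T20-e2)-discharge FILE 1 at `Φ₃`: its rank-free §2 (`coe_inv_glDiagonal`, `diagonal_mul_mul_diagonal_apply`) and §4; brings ★ (T20-c) §General∕§Twist∕§LevelZero (any rank), ★ `CartanUnique`, the `Valued`∕`ValuativeRel` bridge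
import Summits.HodgeConjecture.HodgeConjecture.Theorems.F0P3cIwahoriDatumU2Alg         -- ★ ANY-RANK Iwahori algebra of `U(σ, Φ_N)(K)`: `coe_level_eq_mul` (`K_γ = (K_γ ⊓ N̄)(K_γ ⊓ T)(K_γ ⊓ N)`), `weylLongU_inv_eq`
import HarnessLib

/-!
# h413 ∕ Track B «K2-LIT», (SC-an)₂ Theorem-20 line at `U(1,1)` — DISCHARGE FILE 1: THE DIAGONAL TORUS OF `U(σ, Φ₂)(K)` IN THE HEIGHT-BALL CURRENCY,
# AND THE TWO IWAHORI ORDERS `N̄·T·N`, `N·T·N̄` OF THE LEVEL `K_γ ∩ U(σ, Φ_N)(K)` AT ANY RANK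
# (Harish-Chandra 1970, Part VII §8 Lemmas 54–55 pp. 82–83; Rogawski 1990 §1.10; Casselman 1995 Prop. 1.4.4)

Cell `pub/hodgecm-mathlib`, crux H413 = `stmt-HodgeConjecture-24833`, route of record `HCCMUnconditional`; chair K2-lead (g2), LINE-LEAD∕dealer K2E3-plan (g4),
architect K2E3-p25 (g3).  THEOREMS ONLY (no `def`, no `instance`, no `notation`, no named-fact hypothesis, no `sorry`); lane `--supports stmt-HodgeConjecture-24833 --as helper`,
count-neutral.

PURPOSE.  The (SC-an)₂ road «FC₂»∕(M5h₂) ports the `U(2,1)` engine of (SC-an) to `U(1,1)`; its brick [M4]₂ `K2E3SupercuspidalTruncatedCharThm20Two` (Theorem 20 PAYS the truncated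
supercuspidal character at split-regular elements) needs Harish-Chandra's Theorem 20 at the model `U(σ, Φ₂)(K)`, i.e. the `Fin 2` twin of the ★ discharge chain (T20-c) ∕ U3Torus ∕
U3Inputs ∕ U3 ∕ U3LevelOne of the ABSTRACT ★ (T20-e1)∕(T20-e2)∕(T20-e1′) theorems (`K2E3CuspFormCancellationCore`, `…Heights`, `…LevelOne`, all rank-free).  THIS FILE is the
torus algebra at `Φ₂` (the twin of ★ `K2E3CuspFormCancellationU3Torus` §1∕§3; its §2∕§4 are rank-free and are IMPORTED, not repeated): `K` a field with compatible `Valued K ℤᵐ⁰` ∕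
`ValuativeRel`, `σ : K →+* K` ISOMETRIC, `J = Φ₂`, a diagonal unitary `a = diag(d₀, d₁)` (`σ(d_{1−i}) d_i = 1`, ★ `glDiagonal_mem_unitaryGroupOfForm_antidiagonal_iff`), a uniformiser
`ϖ`, and the height-ball membership of ★ p856390 (`g ∈ Ω_m ⟺ ϖ^m g, ϖ^m g⁻¹ integral`) as a HYPOTHESIS `hmem` on an abstract `Ω : ℕ → Set U`.
WHAT CHANGES FROM `N = 3`: the torus of `U(1,1)` is `{d(α, σ(α)⁻¹)}` — there is NO middle entry of absolute value `1`, `|d₁| = |d₀|⁻¹`, and the single root value above the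
diagonal is `|d₀⁻¹ d₁| = |d₀|⁻²` (below: `|d₀|²`); the `A⁺ = {|d₀| ≥ 1}` ∕ `A⁻ = {|d₀| ≤ 1}` dichotomy and every downstream statement keep their `N = 3` shape verbatim.
* §1 **`v_torus_last_eq_inv`** (`|d₁| = |d₀|⁻¹`).
* §2 HEIGHTS OF TORUS ELEMENTS: `torus_rel`; **`diag_mem_heightBall_iff`** (`a ∈ Ω_h ↔ |ϖ^h d₀| ≤ 1 ∧ |ϖ^h d₀⁻¹| ≤ 1`); DISCRETENESS **`v_inv_le_pow_succ_of_not_mem`** (`|d₀| ≥ 1`,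
  `a ∉ Ω_h ⇒ |d₀⁻¹| ≤ |ϖ^{h+1}|`), **`v_le_pow_succ_of_not_mem`**; the root values `v_ratio_le_inv_of_lt` ∕ `v_ratio_le_of_gt` ∕ `v_ratio_le_one_of_gt` ∕ `v_ratio_le_one_of_lt`.
* §3 ANY RANK `N`: **`coe_level_eq_mul_rev`** (`K_γ = (K_γ ⊓ N)(K_γ ⊓ T)(K_γ ⊓ N̄)`, by inversion of ★ `F0P3cIwahoriDatumU2.coe_level_eq_mul`) and
  **`exists_iwahori_factorisations_of_mem_level`** (both orders elementwise) — the rank-free twin of ★ (T20-c) §Model (stated there at `Φ₃` over the `Φ₃`-only Literature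
  factorisation ★ `coe_comap_congruenceGL_eq_mul`).
FILE 2 (`K2E3CuspFormCancellationU2Inputs`) assembles these into the literal hypotheses of ★ (T20-e2) at `Φ₂`; FILE 3 (`K2E3CuspFormCancellationU2LevelOne`) is Theorem 20 at `U(σ, Φ₂)(K)`.

HONEST LABEL.  HC_CM is proved only modulo the 7 printed citations (2 remaining named inputs: hLiu418 = `stmt-HodgeConjecture-24832`, h413 = `stmt-HodgeConjecture-24833`)
until rung 0 closes; count-neutral helper (valuation bookkeeping only); (SC-an)₂ is NOT ★ until COLL₂ + NC₂ + the whole (M5h₂) chain land.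

## References
* [HarishChandra1970] Harish-Chandra (notes by G. van Dijk), *Harmonic Analysis on Reductive p-adic Groups*, LNM 162 (1970), Part VII §2 p. 69–70 (`‖x‖`, `σ(x)`, the two
  cuspidal pairs), §8 Lemmas 54–55 pp. 80–83 (`(a⁻¹n′a)_{ij} = a_i⁻¹a_j n′_{ij}`, `|ξ_α(a)| = q^{ν(a)α(t(a))}`).
* [Rogawski1990] J. D. Rogawski, *Automorphic Representations of Unitary Groups in Three Variables*, Ann. of Math. Stud. 123 (1990), §1.9–§1.10 pp. 8–9 (`U(1,1)`, `M = {d(α, ᾱ⁻¹)}`).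
* [Casselman1995] W. Casselman, *Introduction to the theory of admissible representations of `p`-adic reductive groups* (1995 notes), Prop. 1.4.4.
* [Serre1979] J.-P. Serre, *Local Fields*, GTM 67 (1979), Ch. I §1 (discrete valuations: `x = π^n u`).
-/

set_option autoImplicit false
set_option linter.dupNamespace false  -- the mandated namespace repeats the single-problem summit's segment (`HodgeConjecture.HodgeConjecture`)

noncomputable section

open scoped MatrixGroups WithZero Pointwise
open ValuativeRel Matrix
open Literature.NumberTheory.Automorphic Literature.NumberTheory.Automorphic.UnitaryGroup
open Summit.HodgeConjecture.HodgeConjecture.Cruxes.H413.K2E3CuspFormCancellationU3Torus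

namespace Summit.HodgeConjecture.HodgeConjecture.Cruxes.H413.K2E3CuspFormCancellationU2Torus

/-! ## §1 Valuations of the diagonal entries of a torus element of `U(σ, Φ₂)` -/

section TorusVal

variable {K : Type*} [Field K] [Valued K ℤᵐ⁰] (σ : K →+* K) (hσv : ∀ x, Valued.v (σ x) = Valued.v x)

include hσv in
/-- **`|d₁| = |d₀|⁻¹`**: for a diagonal unitary `d(d₀, d₁)` of `U(σ, Φ₂)` (`σ(d_{1−i}) d_i = 1`) the relation at `i = 1` (`rev 1 = 0`) is `σ(d₀) d₁ = 1` (`σ` isometric) —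
Rogawski's `M = {d(α, ᾱ⁻¹)}` for `U(1,1)`. [cite: Rogawski1990, §1.9 p. 8; §1.10 p. 9] -/
theorem v_torus_last_eq_inv {d : Fin 2 → Kˣ} (hd : ∀ i : Fin 2, σ (d (Fin.rev i) : K) * (d i : K) = 1) :
    Valued.v (d 1 : K) = (Valued.v (d 0 : K))⁻¹ := by
  have h := hd 1
  have hrev : Fin.rev (1 : Fin 2) = 0 := by decide
  rw [hrev] at h
  have h2 : Valued.v (d 0 : K) * Valued.v (d 1 : K) = 1 := by
    have := congrArg Valued.v h
    rwa [map_mul, hσv, map_one] at this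
  exact eq_inv_of_mul_eq_one_right h2

end TorusVal

/-! ## §2 Heights of torus elements of `U(σ, Φ₂)`, the `A⁺ ∕ A⁻` dichotomy, discreteness, the root values -/

section Heights

variable {K : Type*} [Field K] [Valued K ℤᵐ⁰] (σ : K →+* K) (hσv : ∀ x, Valued.v (σ x) = Valued.v x)
  {J : Matrix (Fin 2) (Fin 2) K} (hJ : J = (StdForm.antidiagonal 2).over K) {ϖ : K} (hϖ : Valued.v ϖ = WithZero.exp (-1 : ℤ))
  (Ω : ℕ → Set ↥(unitaryGroupOfForm σ J))
  (hmem : ∀ (m : ℕ) (g : ↥(unitaryGroupOfForm σ J)), g ∈ Ω m ↔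
    (∀ i j, Valued.v (ϖ ^ m * ((g : GL (Fin 2) K) : Matrix (Fin 2) (Fin 2) K) i j) ≤ 1) ∧
      ∀ i j, Valued.v (ϖ ^ m * (((g : GL (Fin 2) K)⁻¹ : GL (Fin 2) K) : Matrix (Fin 2) (Fin 2) K) i j) ≤ 1)

omit [Valued K ℤᵐ⁰] in
include hJ in
/-- A diagonal element of `U(σ, Φ₂)` satisfies the unitarity relations `σ(d_{1−i}) d_i = 1`. [cite: Rogawski1990, §1.9 p. 8] -/
theorem torus_rel {a : ↥(unitaryGroupOfForm σ J)} {d : Fin 2 → Kˣ} (hd : glDiagonal 2 K d = (a : GL (Fin 2) K)) :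
    ∀ i : Fin 2, σ (d (Fin.rev i) : K) * (d i : K) = 1 := by
  have ha : glDiagonal 2 K d ∈ unitaryGroupOfForm σ ((StdForm.antidiagonal 2).over K) := by rw [hd, ← hJ]; exact a.2
  exact (glDiagonal_mem_unitaryGroupOfForm_antidiagonal_iff σ 2 d).1 ha

include hσv hJ hmem in
/-- **HEIGHT OF A TORUS ELEMENT**: for `a = diag(d) ∈ U(σ, Φ₂)`, `a ∈ Ω_h ↔ |ϖ^h d₀| ≤ 1 ∧ |ϖ^h d₀⁻¹| ≤ 1` (the entries of `a^{±1}` are `d₀^{±1}`, `d₁^{±1}` with `|d₁| = |d₀|⁻¹`,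
and zeros; print's `σ(a) = |ord d₀|`; unlike `N = 3` no `|ϖ^h| ≤ 1` is needed, there being no unit middle entry). [cite: HarishChandra1970, Part VII §2 p. 69]
[cite: Rogawski1990, §1.10 p. 9] -/
theorem diag_mem_heightBall_iff {a : ↥(unitaryGroupOfForm σ J)} {d : Fin 2 → Kˣ} (hd : glDiagonal 2 K d = (a : GL (Fin 2) K)) (h : ℕ) :
    a ∈ Ω h ↔ Valued.v (ϖ ^ h * (d 0 : K)) ≤ 1 ∧ Valued.v (ϖ ^ h * (d 0 : K)⁻¹) ≤ 1 := by
  have hrel := torus_rel σ hJ hd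
  have h1 : Valued.v (d 1 : K) = (Valued.v (d 0 : K))⁻¹ := v_torus_last_eq_inv σ hσv hrel
  have hmat : ((a : GL (Fin 2) K) : Matrix (Fin 2) (Fin 2) K) = diagonal fun i => (d i : K) := by rw [← hd, coe_glDiagonal]
  have hinv : (((a : GL (Fin 2) K)⁻¹ : GL (Fin 2) K) : Matrix (Fin 2) (Fin 2) K) = diagonal fun i => ((d i : K))⁻¹ := by
    rw [← hd, coe_inv_glDiagonal]
  rw [hmem, hmat, hinv]
  constructor
  · rintro ⟨hA, hB⟩
    refine ⟨?_, ?_⟩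
    · have := hA 0 0; rwa [diagonal_apply_eq] at this
    · have := hB 0 0; rwa [diagonal_apply_eq] at this
  · rintro ⟨hA, hB⟩
    have hA' : Valued.v (ϖ ^ h) * Valued.v (d 0 : K) ≤ 1 := by rw [← map_mul]; exact hA
    have hB' : Valued.v (ϖ ^ h) * (Valued.v (d 0 : K))⁻¹ ≤ 1 := by rw [← map_inv₀, ← map_mul]; exact hB
    refine ⟨fun i j => ?_, fun i j => ?_⟩
    · by_cases hij : i = j
      · subst hij
        rw [diagonal_apply_eq, map_mul]
        fin_cases i
        · rw [← map_mul]; exact hA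
        · show Valued.v (ϖ ^ h) * Valued.v (d 1 : K) ≤ 1
          rw [h1]; exact hB'
      · rw [diagonal_apply_ne _ hij, mul_zero, map_zero]; exact zero_le
    · by_cases hij : i = j
      · subst hij
        rw [diagonal_apply_eq, map_mul, map_inv₀]
        fin_cases i
        · show Valued.v (ϖ ^ h) * (Valued.v (d 0 : K))⁻¹ ≤ 1
          exact hB'
        · show Valued.v (ϖ ^ h) * (Valued.v (d 1 : K))⁻¹ ≤ 1
          rw [h1, inv_inv]; exact hA'
      · rw [diagonal_apply_ne _ hij, mul_zero, map_zero]; exact zero_le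

include hσv hJ hϖ hmem in
/-- **`A⁺` FAR OUT CONTRACTS BY `h+1` LEVELS**: for `a = diag(d) ∈ U(σ,Φ₂)` with `1 ≤ |d₀|` and `a ∉ Ω_h`: `|d₀⁻¹| ≤ |ϖ^{h+1}|` (the condition failing in `diag_mem_heightBall_iff`
is `|ϖ^h d₀| ≤ 1`; ★ U3Torus `v_inv_le_pow_succ_of_one_lt` is rank-free). [cite: HarishChandra1970, Part VII §8 Lemma 55 p. 83] -/
theorem v_inv_le_pow_succ_of_not_mem {a : ↥(unitaryGroupOfForm σ J)} {d : Fin 2 → Kˣ} (hd : glDiagonal 2 K d = (a : GL (Fin 2) K))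
    (hplus : 1 ≤ Valued.v (d 0 : K)) {h : ℕ} (hah : a ∉ Ω h) : Valued.v ((d 0 : K))⁻¹ ≤ Valued.v (ϖ ^ (h + 1)) := by
  refine v_inv_le_pow_succ_of_one_lt hϖ (d 0).ne_zero (lt_of_not_ge fun hle => hah ?_)
  refine (diag_mem_heightBall_iff σ hσv hJ Ω hmem hd h).2 ⟨hle, ?_⟩
  rw [map_mul, map_inv₀]
  have hϖh : Valued.v (ϖ ^ h) ≤ 1 := by
    rw [CartanUnique.v_uniformizer_pow hϖ h, ← WithZero.exp_zero, WithZero.exp_le_exp]; omega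
  calc Valued.v (ϖ ^ h) * (Valued.v (d 0 : K))⁻¹ ≤ 1 * 1 := mul_le_mul' hϖh (inv_le_one_of_one_le₀ hplus)
    _ = 1 := one_mul 1

include hσv hJ hϖ hmem in
/-- **`A⁻` FAR OUT CONTRACTS BY `h+1` LEVELS**: for `a = diag(d)` with `|d₀| ≤ 1` and `a ∉ Ω_h`: `|d₀| ≤ |ϖ^{h+1}|`. [cite: HarishChandra1970, Part VII §8 Lemma 55 p. 83] -/
theorem v_le_pow_succ_of_not_mem {a : ↥(unitaryGroupOfForm σ J)} {d : Fin 2 → Kˣ} (hd : glDiagonal 2 K d = (a : GL (Fin 2) K))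
    (hminus : Valued.v (d 0 : K) ≤ 1) {h : ℕ} (hah : a ∉ Ω h) : Valued.v (d 0 : K) ≤ Valued.v (ϖ ^ (h + 1)) := by
  have h0 : (d 0 : K)⁻¹ ≠ 0 := inv_ne_zero (d 0).ne_zero
  have := v_inv_le_pow_succ_of_one_lt hϖ h0 (h := h) (lt_of_not_ge fun hle => hah ?_)
  · rwa [inv_inv] at this
  refine (diag_mem_heightBall_iff σ hσv hJ Ω hmem hd h).2 ⟨?_, hle⟩
  rw [map_mul]
  have hϖh : Valued.v (ϖ ^ h) ≤ 1 := by
    rw [CartanUnique.v_uniformizer_pow hϖ h, ← WithZero.exp_zero, WithZero.exp_le_exp]; omega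
  calc Valued.v (ϖ ^ h) * Valued.v (d 0 : K) ≤ 1 * 1 := mul_le_mul' hϖh hminus
    _ = 1 := one_mul 1

include hσv hJ in
/-- The root value ABOVE the diagonal for `A⁺`: if `1 ≤ |d₀|` then `|d_i⁻¹ d_j| ≤ |d₀⁻¹|` for `i < j` (the single pair `(0,1)`: `|d₀⁻¹ d₁| = |d₀|⁻² ≤ |d₀|⁻¹`).
[cite: HarishChandra1970, Part VII §8 p. 82] -/
theorem v_ratio_le_inv_of_lt {a : ↥(unitaryGroupOfForm σ J)} {d : Fin 2 → Kˣ} (hd : glDiagonal 2 K d = (a : GL (Fin 2) K))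
    (hplus : 1 ≤ Valued.v (d 0 : K)) {i j : Fin 2} (hij : i < j) :
    Valued.v (((d i : K))⁻¹ * (d j : K)) ≤ Valued.v ((d 0 : K))⁻¹ := by
  have h1 : Valued.v (d 1 : K) = (Valued.v (d 0 : K))⁻¹ := v_torus_last_eq_inv σ hσv (torus_rel σ hJ hd)
  have hle : (Valued.v (d 0 : K))⁻¹ ≤ 1 := inv_le_one_of_one_le₀ hplus
  rw [map_mul, map_inv₀, map_inv₀]
  fin_cases i <;> fin_cases j <;> simp at hij
  show (Valued.v (d 0 : K))⁻¹ * Valued.v (d 1 : K) ≤ (Valued.v (d 0 : K))⁻¹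
  rw [h1]; exact mul_le_of_le_one_right' hle

include hσv hJ in
/-- The root value BELOW the diagonal for `A⁻`: if `|d₀| ≤ 1` then `|d_i⁻¹ d_j| ≤ |d₀|` for `j < i` (the single pair `(1,0)`: `|d₁⁻¹ d₀| = |d₀|² ≤ |d₀|`).
[cite: HarishChandra1970, Part VII §8 p. 82] -/
theorem v_ratio_le_of_gt {a : ↥(unitaryGroupOfForm σ J)} {d : Fin 2 → Kˣ} (hd : glDiagonal 2 K d = (a : GL (Fin 2) K))
    (hminus : Valued.v (d 0 : K) ≤ 1) {i j : Fin 2} (hji : j < i) :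
    Valued.v (((d i : K))⁻¹ * (d j : K)) ≤ Valued.v (d 0 : K) := by
  have h1 : Valued.v (d 1 : K) = (Valued.v (d 0 : K))⁻¹ := v_torus_last_eq_inv σ hσv (torus_rel σ hJ hd)
  rw [map_mul, map_inv₀]
  fin_cases i <;> fin_cases j <;> simp at hji
  show (Valued.v (d 1 : K))⁻¹ * Valued.v (d 0 : K) ≤ Valued.v (d 0 : K)
  rw [h1, inv_inv]; exact mul_le_of_le_one_left' hminus

include hσv hJ in
/-- `A⁺` does NOT expand below the diagonal: `1 ≤ |d₀|`, `j < i ⇒ |d_i d_j⁻¹| ≤ 1` (print: `(N̄ ∩ K)^a ⊂ ω₀`). [cite: HarishChandra1970, Part VII §8 p. 81] -/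
theorem v_ratio_le_one_of_gt {a : ↥(unitaryGroupOfForm σ J)} {d : Fin 2 → Kˣ} (hd : glDiagonal 2 K d = (a : GL (Fin 2) K))
    (hplus : 1 ≤ Valued.v (d 0 : K)) {i j : Fin 2} (hji : j < i) :
    Valued.v ((d i : K) * ((d j : K))⁻¹) ≤ 1 := by
  have h := v_ratio_le_inv_of_lt σ hσv hJ hd hplus hji
  have hle : (Valued.v (d 0 : K))⁻¹ ≤ 1 := inv_le_one_of_one_le₀ hplus
  have e : (d i : K) * ((d j : K))⁻¹ = (((d j : K))⁻¹ * (d i : K)) := mul_comm _ _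
  rw [e]
  rw [map_inv₀] at h
  exact h.trans hle

include hσv hJ in
/-- `A⁻` does NOT expand above the diagonal: `|d₀| ≤ 1`, `i < j ⇒ |d_i d_j⁻¹| ≤ 1`. [cite: HarishChandra1970, Part VII §8 p. 81] -/
theorem v_ratio_le_one_of_lt {a : ↥(unitaryGroupOfForm σ J)} {d : Fin 2 → Kˣ} (hd : glDiagonal 2 K d = (a : GL (Fin 2) K))
    (hminus : Valued.v (d 0 : K) ≤ 1) {i j : Fin 2} (hij : i < j) :
    Valued.v ((d i : K) * ((d j : K))⁻¹) ≤ 1 := by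
  have h := v_ratio_le_of_gt σ hσv hJ hd hminus hij
  have e : (d i : K) * ((d j : K))⁻¹ = (((d j : K))⁻¹ * (d i : K)) := mul_comm _ _
  rw [e]
  exact h.trans hminus

end Heights

/-! ## §3 The two Iwahori orders of the level `K_γ ∩ U(σ, Φ_N)(K)`, ANY rank `N` -/

section Iwahori

variable {K : Type*} [Field K] [ValuativeRel K] (σ : K →+* K) {N : ℕ} {J : Matrix (Fin N) (Fin N) K}
  (hJ : J = (StdForm.antidiagonal N).over K)

/-- **THE IWAHORI FACTORISATION OF `K_γ ∩ U(σ, Φ_N)` IN THE ORDER `N · T · N̄`** (`γ < 1`, any rank):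
`K_γ = (K_γ ⊓ N) · (K_γ ⊓ T) · (K_γ ⊓ N̄)` as subsets of `U`, where `N̄ = w₀ N w₀`.  From the `N̄ · T · N` order ★ `F0P3cIwahoriDatumU2.coe_level_eq_mul` by inversion:
`K_γ = K_γ⁻¹ = ((K_γ ⊓ N̄)(K_γ ⊓ T)(K_γ ⊓ N))⁻¹ = (K_γ ⊓ N)(K_γ ⊓ T)(K_γ ⊓ N̄)` (each factor is a subgroup) — the rank-free twin of ★ (T20-c)
`K2E3IwahoriFactorisedLevelU3.coe_comap_congruenceGL_eq_mul_rev`. [cite: HarishChandra1970, Part VII §2 p. 70; §8 p. 80] [cite: Casselman1995, Prop. 1.4.4] -/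
theorem coe_level_eq_mul_rev {γ : ValueGroupWithZero K} (hγ : γ < 1) :
    (((congruenceGL N γ).comap (unitaryGroupOfForm σ J).subtype : Subgroup ↥(unitaryGroupOfForm σ J)) : Set ↥(unitaryGroupOfForm σ J)) =
      (((congruenceGL N γ).comap (unitaryGroupOfForm σ J).subtype ⊓ (borelTriple σ J hJ).N : Subgroup ↥(unitaryGroupOfForm σ J)) :
            Set ↥(unitaryGroupOfForm σ J)) *
        (((congruenceGL N γ).comap (unitaryGroupOfForm σ J).subtype ⊓ (borelTriple σ J hJ).M : Subgroup ↥(unitaryGroupOfForm σ J)) :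
            Set ↥(unitaryGroupOfForm σ J)) *
        (((congruenceGL N γ).comap (unitaryGroupOfForm σ J).subtype ⊓
          ((borelTriple σ J hJ).N).map (MulAut.conj (weylLongU σ hJ)).toMonoidHom : Subgroup ↥(unitaryGroupOfForm σ J)) :
            Set ↥(unitaryGroupOfForm σ J)) := by
  rw [← inv_coe_set (H := ((congruenceGL N γ).comap (unitaryGroupOfForm σ J).subtype : Subgroup ↥(unitaryGroupOfForm σ J))),
    F0P3cIwahoriDatumU2.coe_level_eq_mul σ hJ hγ, _root_.mul_inv_rev, _root_.mul_inv_rev, inv_coe_set, inv_coe_set, inv_coe_set, mul_assoc]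

/-- **BOTH IWAHORI ORDERS AT ONCE, ELEMENTWISE** (the form Theorem 20's rank-one proof consumes: one factorisation per cuspidal pair `(B, A)`, `(B̄, A)`; any rank): for
`γ < 1`, every `k ∈ K_γ ∩ U` is `n̄ t n` AND `n′ t′ n̄′` with `n̄, n̄′ ∈ K_γ ⊓ N̄`, `t, t′ ∈ K_γ ⊓ T`, `n, n′ ∈ K_γ ⊓ N` (★ `F0P3cIwahoriDatumU2.coe_level_eq_mul` and
`coe_level_eq_mul_rev`) — the rank-free twin of ★ (T20-c) `exists_iwahori_factorisations_of_mem_comap_congruenceGL`. [cite: HarishChandra1970, Part VII §8 p. 80]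
[cite: Casselman1995, Prop. 1.4.4] -/
theorem exists_iwahori_factorisations_of_mem_level {γ : ValueGroupWithZero K} (hγ : γ < 1) {k : ↥(unitaryGroupOfForm σ J)}
    (hk : k ∈ (congruenceGL N γ).comap (unitaryGroupOfForm σ J).subtype) :
    (∃ nb t n : ↥(unitaryGroupOfForm σ J),
      nb ∈ (congruenceGL N γ).comap (unitaryGroupOfForm σ J).subtype ⊓ ((borelTriple σ J hJ).N).map (MulAut.conj (weylLongU σ hJ)).toMonoidHom ∧
      t ∈ (congruenceGL N γ).comap (unitaryGroupOfForm σ J).subtype ⊓ (borelTriple σ J hJ).M ∧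
      n ∈ (congruenceGL N γ).comap (unitaryGroupOfForm σ J).subtype ⊓ (borelTriple σ J hJ).N ∧ k = nb * t * n) ∧
    (∃ n t nb : ↥(unitaryGroupOfForm σ J),
      n ∈ (congruenceGL N γ).comap (unitaryGroupOfForm σ J).subtype ⊓ (borelTriple σ J hJ).N ∧
      t ∈ (congruenceGL N γ).comap (unitaryGroupOfForm σ J).subtype ⊓ (borelTriple σ J hJ).M ∧
      nb ∈ (congruenceGL N γ).comap (unitaryGroupOfForm σ J).subtype ⊓ ((borelTriple σ J hJ).N).map (MulAut.conj (weylLongU σ hJ)).toMonoidHom ∧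
      k = n * t * nb) := by
  have hk1 : (k : ↥(unitaryGroupOfForm σ J)) ∈
      ((((congruenceGL N γ).comap (unitaryGroupOfForm σ J).subtype : Subgroup ↥(unitaryGroupOfForm σ J)) : Set ↥(unitaryGroupOfForm σ J))) := hk
  have hk2 := hk1
  rw [F0P3cIwahoriDatumU2.coe_level_eq_mul σ hJ hγ] at hk1
  rw [coe_level_eq_mul_rev σ hJ hγ] at hk2
  obtain ⟨x, hx, n, hn, rfl⟩ := Set.mem_mul.1 hk1
  obtain ⟨nb, hnb, t, ht, rfl⟩ := Set.mem_mul.1 hx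
  obtain ⟨x', hx', nb', hnb', hk'⟩ := Set.mem_mul.1 hk2
  obtain ⟨n', hn', t', ht', rfl⟩ := Set.mem_mul.1 hx'
  exact ⟨⟨nb, t, n, hnb, ht, hn, rfl⟩, ⟨n', t', nb', hn', ht', hnb', hk'.symm⟩⟩

end Iwahori

end Summit.HodgeConjecture.HodgeConjecture.Cruxes.H413.K2E3CuspFormCancellationU2Torus

end
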